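import Literature.NumberTheory.EllipticCurves.Sprung2012.SharpFlatKatoDivisibility
import Literature.NumberTheory.EllipticCurves.Sprung2012.LocalIwasawaModule
import Literature.NumberTheory.EllipticCurves.Kato2004.IwasawaCohomology
import Literature.NumberTheory.EllipticCurves.KatoFineSelmerDual
import Literature.NumberTheory.EllipticCurves.IwasawaSelmer
import HarnessLib

/-!
# Sprung 2012, proof of Thm. 7.14 at the trivial character: the Poitou–Tate sequences (7.18)_∞ and (3) of
# p. 1504 (Kobayashi 2003 (7.16)–(7.20), Prop. 7.1, Thm. 7.3 i)), read IN THE FUNCTIONAL MODEL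
# `H¹_Iw(ℚ_p, T) = Hom(E(ℚ_∞·ℚ_p), ℤ_p)` of `Sprung2012/ColemanMaps.lean`, on PINNED objects in PRINT (covariant)
# KEYING — ONE named construction fact (`thm714seq_sharpFlat_poitouTate_functionalModel`)

Topic `Literature/NumberTheory/EllipticCurves`, cluster `Sprung2012` (namespace = path). ONE new leaf file, sibling
of the landed statement files `SharpFlatColemanKatoZeta.lean` (hypothesis structure `SharpFlatColemanKatoData` +
construction fact `thm714seq_sharpFlatColemanKato_zeta`: the exact sequence (3) per colour with the Coleman isomorphism
composed in, maps EXISTENTIAL — reading flag `Sp12-714seq-eta1-maps-existential`), its contragredient twin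
`SharpFlatColemanKatoContragredient.lean` (`SharpFlatColemanKatoDataContra`, flag `Sp12-714seq-dual-action`), and
`SharpFlatKatoDivisibility.lean` (Thm. 7.14 / 7.16 as named facts); none of them is edited (D-0014). Filed by cell
`bsd-ssimc` (HOME `run/shared/lean/pub/bsd-ssimc/`), width seat `cruxlead-stmt-BirchSwinnertonDyer-19875-w3` (gen 9) under
the LEAD of crux item stmt-BirchSwinnertonDyer-19875 `SprungLowerDivisibilityAtThree`, line `chromatic-common-zeros`, for
the registered stub F-α♮ `IotaDoor.stub_cokerBoundIotaOffT` of the x8 children 22569 / 22901 / 22570 / 23112.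

HONEST FRAMING: a TRANSCRIPTION of published theorems as ONE named construction fact (`def … : Prop`, D-0014;
nothing asserted, no `_holds` — Poitou–Tate duality along the cyclotomic tower, local Tate duality at a supersingular
prime and Kato's `𝐇¹(T)` are not in Mathlib; size XL); net debt +1. Nothing about any curve's Selmer group is computed;
no X8 cell moves; NO summit statement (`BirchSwinnertonDyer`), no K1 `SprungLowerDivisibilityAtThree`, no K_spor, no
main conjecture is proved by anything here. No instance, no notation, no attribute is declared or removed. Typed ≠ proved.

## Why this file (the consumer, and what it replaces)

The cokernel bound F-α♮ of the `ι`-door (crux workfile `Cruxes/SprungLowerDivisibilityAtThree/Lines/child22569_ledger_door.lean`,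
stub `stub_cokerBoundIotaOffT`: «`min(ℓ_𝔭 Λ/range Cs.colMap, ℓ_𝔭 Λ/range Cf.colMap) ≤ ℓ_{ι𝔭} X₀`») was reduced by
width seat w2 (gen 9) to ONE inequality between local masses of the PINNED duals,
(M1) «`min(ℓ_𝔭 X♯, ℓ_𝔭 X♭) ≤ ℓ_𝔭 X₀ + ℓ_𝔭 tors_Λ X(E/ℚ_∞)`» (`Summits/…/Theorems/…CokerBoundByMass{,Skeleton,Matar,Keying}.lean`:
`cokerBoundIotaOffT_of_cotorsion_of_matar`, `massCotorsion_of_contraFamily`, and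
`min_lengthAt_le_fine_add_torsion_of_poitouTate_functionalModel` — (M1) at one prime from «a Poitou–Tate datum in the
functional model»: `loc : H → P`, `toX : P → X` exact, `πY : X ↠ X₀` with `ker πY = range toX`, `π• : X ↠ X^•` with
`ker π• = toX(Ker Col^•)`, `H` cyclic, `loc h₀ ≠ 0`; the joint Coleman map, its injectivity and its cokernel `Λ/(T)`
being tree theorems, `Sprung2012.exists_linearMap_isColemanPair_cokernel_of_hondaSystem_rat`). THIS FILE TYPES THAT
DATUM — the printed Poitou–Tate sequences behind Sprung's (3) — on the tree's PINNED objects: Kato's covariant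
`I : Kato2004.IwasawaH1Data W p κ γ` (`T = conj_γ − 1` on `lim←_n H¹(ℤ[ζ_{p^n}, 1/p], T_pW)`), the functional model
`P = (localTowerPointsOfEmb κ ι W →+ ℤ_p)` with its covariant `Λ`-structure `Sprung2012.moduleOfGenerator`
(`T = Θ_g − 1`, `Θ_g z = z ∘ g⁻¹`, `LocalIwasawaModule.lean`), and the Pontryagin-dual data of `Sel_{p^∞}(E/ℚ_∞)`,
`Sel₀(ℚ_∞, E[p^∞])`, `Sel^•(E/ℚ_∞)` WITH THEIR CONTRAGREDIENT (= natural) `Λ`-STRUCTURE — key `γ⁻¹`: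
`(T·x)(s) = x(conj_{γ⁻¹} s) − x(s)` is the natural action of `γ` on a character group — exactly as the contragredient
twins `SharpFlatColemanKatoDataContra` / `Kato2004/…Contragredient` do against the covariant `I`. In that keying all
four printed arrows are `Λ`-LINEAR; the tree-keyed (`γ`) duals are the `ι`-twists of these (kernel theorems
`sharpFlatSelmerDualData_exists_involTwist`, `Kato2004.fineSelmerDualData_exists_involTwist`,
`ChromaticCommonZeros.selmerDualData_exists_involTwist`), and the consumer (M1) is keying-immune
(`massCotorsion_of_contraFamily`), so NO `γ`-keyed twin of this fact is stated (it would read print∘`ι`, cf. the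
referee notes R-228 / R-271 of cell `bsd-print-x8` on `thm716_…`). With this fact, `Kato2004.thm12_4` (3) (`𝐇¹` free
of rank one: `E[p]` is irreducible at a supersingular `p`) and the two facts already consumed by w2
(`matar2020_thm11_selmerDualTorsion_pseudoIso_fineSelmerDual`, `Kato2004_fineSelmerDual_isTorsion`), the registered
stub F-α♮ is a kernel theorem modulo named printed facts only (Summits-side file
`Theorems/SignedLowerHalvesSprungLowerDivisibilityAtThreeCokerBoundByMassPoitouTate.lean`, this seat).

## Source, verbatim

S. Kobayashi, *Iwasawa theory for elliptic curves at supersingular primes*, Invent. Math. **152** (2003) 1–36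
[Kobayashi2003] (held `paper:doi-10-1007-s00222-002-0265-4`, page = file number, read by this seat 2026-08-28), p. 12:
"We have `E(K_{n,v}) ⊗ ℚ_p/ℤ_p = 0` for the places `v` not lying above `p`. By definition, the exact annihilator of
`E^±(k_n) ⊗ ℚ_p/ℤ_p` with respect to the local Tate pairing is `H¹_±(k_n, T)`. The exact annihilator of
`E(k_n) ⊗ ℚ_p/ℤ_p` is `E(k_n) ⊗ ℤ_p`. Hence from the Tate-Poitou exact sequence, we have
`0 → X₀(E/K_n) → H²(G_{n,S}, T) → ⊕_{v∈S_n} H²(K_{n,v}, T)`, (7.16)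
`H¹(G_{n,S}, T) → H¹(k_n, T)/H¹_±(k_n, T) → X^±(E/K_n) → X₀(E/K_n) → 0`, (7.17)
`H¹(G_{n,S}, T) → H¹(k_n, T)/E(k_n) ⊗ ℤ_p → X(E/K_n) → X₀(E/K_n) → 0`. (7.18) (cf. Perrin-Riou [16], Appendix A. 3.2.)
Taking the limit of the above exact sequences, we have … `𝐇¹_{/S}(T) → 𝐇¹_Iw(T)/𝐇¹_{Iw,±}(T) → X^±(E/K_∞) → X₀(E/K_∞) → 0`.
(7.20) **Proposition 7.1 (Kurihara).** i) The canonical mapping `𝐇¹(T) → 𝐇¹_{/S}(T)` is an isomorphism. ii) `𝐇²(T)` is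
isomorphic to `X₀(E/K_∞)` as `Λ`-module." p. 13: "**Theorem 7.3.** i) We have an exact sequence
`0 → 𝐇¹(T) → 𝐇¹_Iw(T)/𝐇¹_{Iw,±}(T) → X^±(E/K_∞) → X₀(E/K_∞) → 0`. (7.21) … *Proof.* The exact sequence is nothing
but (7.20) except for the injectivity … Since `𝐇¹(T)` is a free `Λ`-module of rank 1 (cf. Theorem 5.1 iii)), this
morphism is injective if and only if it is a non-zero map. Hence i) follows from Theorem 6.3 and Rohrlich's theorem".
F. E. I. Sprung, *Iwasawa theory for elliptic curves at supersingular primes: A pair of main conjectures*, J. Number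
Theory **132** (2012) 1483–1506 [Sprung2012] (held `paper:doi-10-1016-j-jnt-2011-11-003`, `p0022` = printed p. 1504, read
by this seat 2026-08-28; the ♯/♭ glyphs are lost in the text layer, `∗ ∈ {♯, ♭}`): "**Definition 7.13.** `X⁰(E/K_∞)` is the
Pontryagin dual to Kurihara's Selmer group …, which is `Sel⁰(E/K_∞) := Ker(Sel(E/K_∞) → E(K_{∞,𝔭}) ⊗ ℚ_p/ℤ_p)`.
**Theorem 7.14.** … *Proof.* From [Kobayashi, Proposition 7.1 and the limit of (7.18)], we have the exact sequence
`𝐇¹(T)^η → H¹_Iw(T)^η → X(E/K_∞)^η → X⁰(E/K_∞)^η → 0`, noting that `lim←_n E(K_{n,𝔭_n}) ⊗̂ ℤ_p = 0`. Since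
`L^∗_p(E, η, X) ≠ 0` by assumption, the arguments in the proof of [Kobayashi, Theorem 7.3 i] provide us with an
injection `ι` in the exact sequence of `ℤ_p[[X]]`-modules
`0 → 𝐇¹(T)^η →^ι H¹_Iw(T)^η / Ker ε_η Col^∗ → X^∗(E/K_∞)^η → X⁰(E/K_∞)^η → 0`. (3) To see that the entire sequence is
exact, we can use the Cassels–Poitou–Tate exact sequence (cf. [PR, Appendix A.3.2] or [CS, Theorem 1.5]) and the
discussion in [Kobayashi] preceding (7.16)." With Def. 7.9 (p. 1503: "`E^♯_{∞,𝔭}` (resp. `E^♭_{∞,𝔭}`) [is] the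
exact annihilator of `Ker Col^♯` (resp. `Ker Col^♭`) under the local Tate pairing"), Lemma 7.10
("`E(K_{∞,𝔭}) ⊗ ℚ_p/ℤ_p = lim→_n H¹(K_{n,𝔭_n}, V/T)`"), Def. 7.11 (`Sel^∗ := Ker(Sel → E(K_{∞,𝔭}) ⊗ ℚ_p/ℤ_p / E^∗_{∞,𝔭})`)
and Prop. 6.14 (p. 1498: "at least one of `L♯_p(E, η, X)` and `L♭_p(E, η, X)` is a nonzero function").

## Transcription (for the referee): what the fact says, clause by clause, and why it is print

Frame: `W/ℚ` elliptic, globally minimal; `p ≠ 2` of good reduction with `p ∣ a_p` (odd supersingular — ANY `a_p`, so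
`(3, ±3)` included: §7 assumes only "`p` odd supersingular"); the cyclotomic `ℤ_p`-extension `κ` with topological
generator `γ` (`κ(γ) = 1`); the place `v ∣ p` (`ι = closureEmb`), a local lift `g` of `γ` (`κ(res g) = 1`), a Honda system
`(cneg, c)` (Thm. 2.2 — the data through which the tree DEFINES `Ker Col^•`, `E^•_{∞,𝔭}`, `Sel^•`: `ColemanMaps.lean`,
`SharpFlatSelmer.lean`; the binder list of `thm714_sharpFlatSelmerDual_finite_torsion`); Kato's pinned
`I : Kato2004.IwasawaH1Data W p κ γ` (`I.H = 𝐇¹(T)^{η=1}`, covariant: `T = conj_γ − 1`); the functional model `P` of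
`H¹_Iw(T)^{η=1}` = `lim←_n H¹(ℚ_{n,p}, T)` (TRANSCRIPTION CONVENTION of `ColemanMaps.lean`: local Tate duality with
Lemma 7.10 identifies `H¹_Iw(T)` with `Hom(E(ℚ_∞·ℚ_p) ⊗ ℚ_p/ℤ_p, ℚ_p/ℤ_p) = Hom_ℤ(E(ℚ_∞·ℚ_p), ℤ_p)`, the Galois action
`(σz)(x) = z(σ⁻¹x)` being `moduleOfGenerator`'s `Θ_g`); and a Pontryagin-dual datum `S'` of `Sel_{p^∞}(E/ℚ_∞)`
(`W.selmerInfty κ`; `WeierstrassCurve.SelmerDualData`) keyed by `γ⁻¹`, i.e. with the NATURAL `Λ`-structure of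
`X(E/K_∞)` (`(γ·x)(s) = x(γ⁻¹s) = x(conj_{γ⁻¹} s)`). Then `thm714seq_sharpFlat_poitouTate_functionalModel` records the
existence of `Λ`-linear `loc : I.H → P` («localisation at `𝔭`», through Prop. 7.1 i) `𝐇¹(T) = 𝐇¹_{/S}(T)`) and
`toX : P → S'.X` («the arrow `H¹_Iw(T) → X(E/K_∞)` of (7.18)_∞», Pontryagin-transpose of `Sel → E(K_{∞,𝔭}) ⊗ ℚ_p/ℤ_p`,
its source `H¹_Iw(T)/lim← E(K_{n,𝔭_n}) ⊗̂ ℤ_p = H¹_Iw(T)` by the vanishing of universal norms at a supersingular prime,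
"noting that `lim←_n E(K_{n,𝔭_n}) ⊗̂ ℤ_p = 0`") such that:
* `Function.Injective loc` — the "injection `ι`" of (3) (`ι` = `loc` followed by `mod Ker Col^∗`, for a colour with
  `L^∗_p ≠ 0`, which exists by Prop. 6.14; Kobayashi Thm. 7.3 i): "injective if and only if it is a non-zero map …
  Rohrlich"); never stronger than print;
* `Function.Exact loc toX` — exactness of (7.18)_∞ at `H¹_Iw(T)`;
* for every dual datum `Y'` of `Sel₀(ℚ_∞, E[p^∞])` (`W.FineSelmerDualData κ γ⁻¹` = Def. 7.13's `X⁰(E/K_∞)` on the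
  `Δ`-trivial component — Kurihara's `Sel⁰`, the same reading as `SharpFlatColemanKatoData.exact` and
  `Kato2004.exists_divisibilityInputs_fineQuotient`): a SURJECTIVE `Λ`-linear `πY : S'.X → Y'.X` with
  `ker πY = range toX` — exactness of (7.18)_∞ at `X(E/K_∞)` and at `X⁰(E/K_∞)` (the printed arrow is the
  Pontryagin-transpose of `Sel⁰ ≤ Sel`);
* for every colour `•` and every dual datum `D'` of `Sel^•(E/ℚ_∞)` (`SharpFlatSelmerDualData W κ γ⁻¹ ι a_p g c •`, Def.
  7.11): a SURJECTIVE `Λ`-linear `π• : S'.X → D'.X` (Pontryagin-transpose of `Sel^• ≤ Sel`, Def. 7.11) whose KERNEL is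
  `toX(Ker Col^•)` (`Sprung2012.colemanKer`, Def. 7.9) — this is (3) at `•` COMBINED with (7.18)_∞, both being
  quotients of ONE Cassels–Poitou–Tate sequence ("the discussion in [Kobayashi] preceding (7.16)": the local term of
  (7.17)/(3) is `H¹_Iw(T)` modulo the exact annihilator `Ker Col^•` of `E^•_{∞,𝔭}`, Def. 7.9, that of (7.18) is
  `H¹_Iw(T)` modulo the exact annihilator `lim← E ⊗̂ ℤ_p = 0` of `E(K_{∞,𝔭}) ⊗ ℚ_p/ℤ_p`): if `x ∈ X` dies in `X^•` it
  dies in `X⁰`, so `x = toX(z)` by (7.18)_∞; the class of `z` in `H¹_Iw/Ker Col^•` dies in `X^•`, so by (3)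
  `z ∈ loc(𝐇¹) + Ker Col^•` and `x ∈ toX(Ker Col^•)` (`toX ∘ loc = 0`); conversely `toX(Ker Col^•)` dies in `X^•` because
  `Sel^•` pairs to zero with `Ker Col^•` (Def. 7.9 / 7.11).
WEAKER THAN PRINT, never stronger: the identity of `loc`, `toX`, `πY`, `π•` is forgotten up to the listed properties
(reading flag `Sp12-714seq-PT-maps-existential`, as for the sibling's `exact`); the `Δ`-trivial component is read as the
`ℚ_∞`-object (flag `Sp12-eta1-Ftower`, inherited from `SharpFlatKatoDivisibility.lean`); the transcription convention
`H¹_Iw(T) ≅ Hom_ℤ(E(ℚ_∞·ℚ_p), ℤ_p)` is that of `ColemanMaps.lean` (flag `Sp12-HIw-functional-model`). NOT here: the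
Coleman maps on `P` (tree theorems: `exists_linearMap_isColemanPair…`, Props. 7.3/7.6 `ColemanMapSurjectiveProofs`), the
freeness of `𝐇¹(T)` (`Kato2004.thm12_4` (3)), Thm. 7.14 / 7.16 / Main Conj. 7.21, any `γ`-keyed twin (print∘`ι`).

## References
* [Sprung2012] F. E. I. Sprung, J. Number Theory 132 (2012): Prop. 6.14 (p. 1498); Def. 7.9, Lemma 7.10, Def. 7.11
  (p. 1503); Def. 7.13, Thm. 7.14 with (3) (p. 1504); Prop. 7.19 (p. 1505); Thm. 2.2 (p. 1487); §2 p. 1486 (`γ ↦ 1 + X`).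
* [Kobayashi2003] S. Kobayashi, Invent. Math. 152 (2003): (7.16)–(7.20), Prop. 7.1 (p. 12); Cor. 7.2, Thm. 7.3 (p. 13);
  Thm. 5.1 iii) and Remark 5.3 i) (pp. 9–10).
* [Kato2004Asterisque] K. Kato, Astérisque 295 (2004): §12.2 (p. 220), Thm. 12.4 (p. 221), §17.13 (17.13.1) (pp. 279–280).
* [PerrinRiou1995Asterisque229] B. Perrin-Riou, Astérisque 229 (1995), Appendix A.3.2 (the Poitou–Tate sequence).
* Tree: `Sprung2012/{ColemanMaps, LocalIwasawaModule, SharpFlatSelmer, SharpFlatKatoDivisibility, SharpFlatColemanKatoZeta,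
  SharpFlatColemanKatoContragredient}.lean`, `Kato2004/IwasawaCohomology.lean`, `IwasawaSelmer.lean`, `KatoFineSelmerDual.lean`.
-/

noncomputable section

open scoped NumberField

open NumberField IsDedekindDomain WeierstrassCurve Field
  Literature.NumberTheory.EllipticCurves Literature.NumberTheory.EllipticCurves.ZpExtension
  Literature.NumberTheory.EllipticCurves.Sprung2017

namespace Literature.NumberTheory.EllipticCurves.Sprung2012

/-- **Sprung 2012, proof of Thm. 7.14 at the trivial character — the Poitou–Tate sequences (7.18)_∞ and (3) in the
functional model of `H¹_Iw(ℚ_p, T)`, print (covariant) keying.** For every elliptic curve `E/ℚ` with globally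
minimal model `W` (the structure fact `ContinuousSMul ℤ_[p] (T_pW)` as an instance BINDER, as in `Kato2004.thm12_4`),
every prime `p ≠ 2` of good reduction with `p ∣ a_p` (odd supersingular, any `a_p`), the cyclotomic `ℤ_p`-extension
`κ` with topological generator `γ`, the place `v ∣ p`, a local lift `g` of `γ`, a Honda system `(cneg, c)` (the data
defining `Ker Col^•` and `Sel^•` in the tree), every pinned `I : Kato2004.IwasawaH1Data W p κ γ` (`𝐇¹(T)`, `T = conj_γ − 1`)
and every Pontryagin-dual datum `S'` of `Sel_{p^∞}(E/ℚ_∞)` with its NATURAL `Λ`-structure (key `γ⁻¹`): with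
`P = (E(ℚ_∞·ℚ_p) →+ ℤ_p)` carrying `moduleOfGenerator` (`= H¹_Iw(T)`, transcription convention of `ColemanMaps.lean`),
there are `Λ`-linear `loc : 𝐇¹ → P` and `toX : P → X(E/ℚ_∞)` with `loc` INJECTIVE (the injection `ι` of (3); Kobayashi
Thm. 7.3 i) with Prop. 6.14), `𝐇¹ →^{loc} H¹_Iw(T) →^{toX} X(E/ℚ_∞)` EXACT ((7.18)_∞, universal norms vanish at a
supersingular prime), for every natural-keyed fine dual datum `Y'` a surjection `πY : X ↠ X⁰` with `ker πY = range toX`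
((7.18)_∞ at `X` and `X⁰`, Def. 7.13), and for every colour `•` and every natural-keyed dual datum `D'` of `Sel^•` a
surjection `π• : X ↠ X^•` with kernel `toX(Ker Col^•)` ((3) combined with (7.18)_∞; Def. 7.9 / 7.11:
`E^•_{∞,𝔭}` is the exact annihilator of `Ker Col^•`). A CONSTRUCTION fact, weaker than print (maps existential up to the
listed properties; module docstring: transcription, flags `Sp12-714seq-PT-maps-existential`, `Sp12-eta1-Ftower`,
`Sp12-HIw-functional-model`); nothing asserted; no `_holds` expected soon (Poitou–Tate along the tower, local Tate
duality, Kato's `𝐇¹`: size XL). Consumer: F-α♮ of crux `SprungLowerDivisibilityAtThree` via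
`ChromaticCommonZeros.min_lengthAt_le_fine_add_torsion_of_poitouTate_functionalModel`.
[cite: Sprung2012, Thm. 7.14 proof with exact sequence (3) and Def. 7.13 (p. 1504), Def. 7.9, Lemma 7.10, Def. 7.11 (p. 1503), Prop. 6.14 (p. 1498)]
[cite: Kobayashi2003, (7.16)–(7.20) and Prop. 7.1 (p. 12), Thm. 7.3 i) (p. 13)]
[cite: Kato2004Asterisque, §12.2 (p. 220) and §17.13 (17.13.1) (pp. 279–280)] -/
def thm714seq_sharpFlat_poitouTate_functionalModel : Prop :=
  ∀ (W : WeierstrassCurve ℚ) [W.IsElliptic] [W.IsGloballyMinimal] (p : ℕ) [Fact p.Prime]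
    [ContinuousSMul ℤ_[p] (W.tateModule p)],
    p ≠ 2 → W.HasGoodReductionAtPrime p → (p : ℤ) ∣ W.frobeniusTrace p →
    ∀ (κ : ZpExtension ℚ p) (γ : Field.absoluteGaloisGroup ℚ),
      κ.IsCyclotomic → κ.IsTopGenerator γ →
    ∀ (v : HeightOneSpectrum (𝓞 ℚ)), (p : 𝓞 ℚ) ∈ v.asIdeal →
    ∀ (g : Field.absoluteGaloisGroup (v.adicCompletion ℚ))
      (hg : κ.IsTopGenerator (resGalOfEmb (closureEmb (K := ℚ) (v.adicCompletion ℚ)) g)),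
    ∀ (cneg : localPoints W (v.adicCompletion ℚ)) (c : ℕ → localPoints W (v.adicCompletion ℚ)),
      IsHondaSystem κ (closureEmb (K := ℚ) (v.adicCompletion ℚ)) W (W.frobeniusTrace p) g cneg c →
    ∀ (I : Kato2004.IwasawaH1Data W p κ γ) (S' : W.SelmerDualData κ γ⁻¹),
    letI := moduleOfGenerator κ (closureEmb (K := ℚ) (v.adicCompletion ℚ)) W hg
    ∃ (loc : I.H →ₗ[IwasawaAlgebra p]
        (localTowerPointsOfEmb κ (closureEmb (K := ℚ) (v.adicCompletion ℚ)) W →+ ℤ_[p]))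
      (toX : (localTowerPointsOfEmb κ (closureEmb (K := ℚ) (v.adicCompletion ℚ)) W →+ ℤ_[p])
        →ₗ[IwasawaAlgebra p] S'.X),
      Function.Injective loc ∧ Function.Exact loc toX ∧
      (∀ Y' : W.FineSelmerDualData κ γ⁻¹,
        ∃ πY : S'.X →ₗ[IwasawaAlgebra p] Y'.X,
          Function.Surjective πY ∧ LinearMap.ker πY = LinearMap.range toX) ∧
      ∀ (col : Chroma)
        (D' : SharpFlatSelmerDualData W κ γ⁻¹ (closureEmb (K := ℚ) (v.adicCompletion ℚ))
          (W.frobeniusTrace p) g c col),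
        ∃ π : S'.X →ₗ[IwasawaAlgebra p] D'.X, Function.Surjective π ∧
          ∀ x : S'.X, x ∈ LinearMap.ker π ↔
            x ∈ toX '' colemanKer κ (closureEmb (K := ℚ) (v.adicCompletion ℚ)) W (W.frobeniusTrace p) g c col

end Literature.NumberTheory.EllipticCurves.Sprung2012

end
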